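import Summits.ResolutionOfSingularities.ResolutionOfSingularities.Theorems.FrobeniusClosingNoPeriodicIsolatedAtomOfEngine
import Summits.ResolutionOfSingularities.ResolutionOfSingularities.Theorems.WildConesNarrowRunsDie

/-!
# `NoPeriodicIsolatedAtom` from `ClassicalRegimes` alone
# (crux stmt-ResolutionOfSingularities-16344, line `ridge_rank`, lead; Theorems-side assembly, last edge)

`Theorems/FrobeniusClosingNoPeriodicIsolatedAtomOfEngine.lean` proves
`noPeriodicIsolatedAtom_of_wildCones : NarrowRunsDie → ClassicalRegimes → NoPeriodicIsolatedAtom`.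
The sibling crux `WildCones.NarrowRunsDie` (stmt-ResolutionOfSingularities-16882) is CLOSED in the tree
(`Theorems/WildConesNarrowRunsDie.lean`, `NarrowRunsDie_proof`), so the crux
`FrobeniusClosing.NoPeriodicIsolatedAtom` now depends on exactly ONE named statement,
`WildCones.ClassicalRegimes` (stmt-ResolutionOfSingularities-16884: no eternal isolated multiplicity-`p`
chain in the classical regimes `n ≤ 2 ∨ p = 2`).
-/

noncomputable section

-- single-problem summit: the doubled namespace component is forced by the tree layout
set_option linter.dupNamespace false

namespace Summit.ResolutionOfSingularities.ResolutionOfSingularities.Theorems.FrobeniusClosing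

open Summit.ResolutionOfSingularities.ResolutionOfSingularities.Theses.FrobeniusClosing (NoPeriodicIsolatedAtom)
open Summit.ResolutionOfSingularities.ResolutionOfSingularities.Theses.WildCones (ClassicalRegimes)

/-- **Registered helper goal `noPeriodicIsolatedAtom_of_classicalRegimes`** — the crux
`NoPeriodicIsolatedAtom` from the ONE remaining sibling crux `WildCones.ClassicalRegimes`: unwind the
periodic chain to an eternal isolated multiplicity-`p` chain over the same perfect field (successor
transport, landed); the classical regimes `n ≤ 2 ∨ p = 2` are the hypothesis; otherwise the cone exit lemma
(`ConeExit_proof`) puts every state on the ridge with invariance rank `1`, excluded by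
`NarrowRunsDie_proof`. [cite: HauserPerlega2019, §1 p. 3 and §5] -/
theorem noPeriodicIsolatedAtom_of_classicalRegimes : ClassicalRegimes → NoPeriodicIsolatedAtom :=
  noPeriodicIsolatedAtom_of_wildCones
    Summit.ResolutionOfSingularities.ResolutionOfSingularities.Theorems.NarrowRunsDie_proof

end Summit.ResolutionOfSingularities.ResolutionOfSingularities.Theorems.FrobeniusClosing

end
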